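import Mathlib
import Summits.KontsevichZagierPeriods.Zeta5Search.ThirdOrderNorms
import Summits.KontsevichZagierPeriods.Zeta5Search.ThirdOrderDoubleLive
import Summits.KontsevichZagierPeriods.Zeta5Search.ThirdDigitVTransport
import Summits.KontsevichZagierPeriods.Zeta5Search.SelfConjugateOddProof
import Summits.KontsevichZagierPeriods.Zeta5Search.CollinearityDigits
import HarnessLib

/-!
# ζ(5) search — the DOUBLY RAISED PAIR IDENTITY (P2 of gen-2 g10's THEOREM A⁗, REPORT-gen2-g10 §6.4)

Cell `pub-zeta5` (HONEST FRAMING: systematic search; no irrationality claim unless certified), typer seat generation 12.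
For a pole class `z` of EVEN exponent `m+2 ≤ −2` whose type list is an admissible double raise of the palindrome `T`, and its
conjugate `z̄` (`Ω = W/(−p)^{m+3}`, `N = V/(−p)^m`): **`(Ω,N)_z + (Ω,N)_z̄ ≡ a_z · τ(T) (mod p³)`**, `a_z = p²c ĝ_z`, `c ∈ ℤ`
(`double_pair₃`).  Only first digits matter (`subsub3W_norm`, `subsub3V_norm`); `z` is not self-conjugate (`selfConjugateOdd_holds`,
the exponent being even); `ĝ_z̄ ≡ −ĝ_z (mod p)` (`gHat_pair_even_first`); and `σ(z) − σ(z̄) = cτ(T)` (`live_pair_double`).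
`p`-adic valuations of rational numbers; nothing here concerns irrationality.
-/

noncomputable section

open Finset PowerSeries

namespace Summit.KontsevichZagierPeriods.Zeta5Search.SecondOrder

open Summit.KontsevichZagierPeriods.Zeta5Search.DualSeries (InBox)
open Summit.KontsevichZagierPeriods.Zeta5Search.CasoratianValuation (InPolytope)
open Summit.KontsevichZagierPeriods.Zeta5Search.ClusterValuation
open Summit.KontsevichZagierPeriods.Zeta5Search.PadicSeries
open Summit.KontsevichZagierPeriods.Zeta5Search.CellA (classW padicNorm_pow_eq padicNorm_p gHat_conj)
open Summit.KontsevichZagierPeriods.Zeta5Search.LevelClass (level_mem)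
open Summit.KontsevichZagierPeriods.Zeta5Search.BigPrime (padicNorm_mul_le_one)
open Summit.KontsevichZagierPeriods.Zeta5Search.CellKit (conj_level)

variable {p : ℕ} [hp : Fact p.Prime]

/-- **Conjugate unit at even exponent, first order**: `‖ĝ_x̄ + ĝ_x‖ ≤ p⁻¹`. -/
theorem gHat_pair_even_first (b : ℕ → ℤ) (hb : InPolytope b) (hp5 : 5 ≤ p) {x L : ℕ} (hx : x < p)
    (hL : x + L * p ≤ (b 0).toNat) (hL' : (b 0).toNat < x + L * p + p) (hc : ¬ CentreIn b p x) (heven : Even (classExp b p x)) :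
    padicNorm p (gHat b p (conjClass b p x) + gHat b p x) ≤ (p : ℚ) ^ (-(1 : ℤ)) := by
  have hq := level_mem b hx hL hL' le_rfl
  have hx0 : x ∈ classSet b p x := by simpa using level_mem b hx hL hL' (Nat.zero_le L)
  have hconj : conjClass b p x = (b 0).toNat - (x + L * p) := CellKit.conjClass_eq_level b hL hL'
  have hG2 := gHat_conj b p x (x + L * p) hb hp.out hp5 hx hc hq
  have hodd : Odd (classExp b p x + 1) := heven.add_one
  rw [hodd.neg_one_zpow, neg_one_mul] at hG2
  rw [hconj, hG2, show -gHat b p (x + L * p) + gHat b p x = -(gHat b p (x + L * p) - gHat b p x) by ring, padicNorm.neg]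
  exact (padicNorm_gHat_class b hb hp5 hx hq hx0).2

section Double

variable (b : ℕ → ℤ) (hb : InPolytope b) (hp5 : 5 ≤ p) (hpn : (p : ℤ) ≤ b 0) (hwin : (b 0 + 2 : ℤ) < (p : ℤ) ^ 2)
  {T : List ℤ} (hT : T.reverse = T) {z : ℕ} (hz : z < p) (hpole : 1 ≤ classPoleCount b p z)
  {m : ℤ} (hme : Even m) (hE : classExp b p z = m + 2) (hm : m + 2 ≤ -2)
include hb hp5 hpn hwin hT hz hpole hme hE hm

/-- **P2 — the DOUBLY RAISED PAIR to relative order `p²`.**  `(Ω,N)_z + (Ω,N)_z̄ ≡ a·(τ_W, τ_V)(T) (mod p³)` with `‖aτ‖ ≤ p⁻¹`. -/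
theorem double_pair₃ (hr : isRaise2 T (classTypeList b p z) = true) :
    ∃ a : ℚ, (padicNorm p (a * typeTauW (tTop T) (tList T)) ≤ (p : ℚ) ^ (-(1 : ℤ)) ∧
        padicNorm p (a * typeTauV (tTop T) (tList T)) ≤ (p : ℚ) ^ (-(1 : ℤ))) ∧
      padicNorm p (classW b p z / (-(p : ℚ)) ^ (m + 3) + classW b p (conjClass b p z) / (-(p : ℚ)) ^ (m + 3)
        - a * typeTauW (tTop T) (tList T)) ≤ (p : ℚ) ^ (-(3 : ℤ)) ∧
      padicNorm p (classV b p z / (-(p : ℚ)) ^ m + classV b p (conjClass b p z) / (-(p : ℚ)) ^ m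
        - a * typeTauV (tTop T) (tList T)) ≤ (p : ℚ) ^ (-(3 : ℤ)) := by
  have h0 : 0 ≤ b 0 := hb.1.1
  have hp0 : (p : ℚ) ≠ 0 := Nat.cast_ne_zero.2 hp.out.ne_zero
  have hp2 : p ≠ 2 := by omega
  have hp1' : (1 : ℚ) ≤ p := by exact_mod_cast hp.out.one_le
  obtain ⟨-, -, -, hn⟩ := thmA_data b hb hwin
  have hzn := le_b0_of_lt b hpn hz
  obtain ⟨hL, hL'⟩ := level_bounds' (p := p) b hzn
  have hEc : classExp b p (conjClass b p z) = m + 2 := by rw [classExp_conj b h0 hzn]; exact hE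
  have hpolec : 1 ≤ classPoleCount b p (conjClass b p z) := by rw [classPoleCount_conj b h0 hzn]; exact hpole
  obtain ⟨hz', -, -⟩ := conj_level b hz hL hL'
  have heven : Even (classExp b p z) := by rw [hE]; exact hme.add (by decide : Even (2 : ℤ))
  -- the class is not self-conjugate (its exponent is even)
  have hcz : ¬ CentreIn b p z := fun hcen =>
    (Int.not_odd_iff_even.2 heven) (selfConjugateOdd_holds b p z hb hp.out hp5 hz hpole hcen)
  -- first digits of both classes
  have hWz := subsub3W_norm b hb hp5 hwin hz hpole hE
  have hWc := subsub3W_norm b hb hp5 hwin hz' hpolec hEc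
  have hVz := subsub3V_norm b hb hp5 hwin hz hpole hE
  have hVc := subsub3V_norm b hb hp5 hwin hz' hpolec hEc
  obtain ⟨c, hcW, hcV⟩ := live_pair_double b hb hpn hT hz hpole (by omega) hcz hr
  have hgg := gHat_pair_even_first b hb hp5 hz hL hL' hcz heven
  have hg1 : padicNorm p (gHat b p z) ≤ 1 := padicNorm_gHat_le_one' b hp5 z
  have hw1 : ∀ x, padicNorm p (wHat b p x) ≤ 1 := fun x => LevelClass.padicNorm_wHat_le_one b h0 hn hp2 x
  have hv1 : ∀ x, padicNorm p (vHat b p x) ≤ 1 := fun x => (LevelClass.padicNorm_vHat_le_one b h0 hn hp2 : padicNorm p (vHat b p x) ≤ 1)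
  -- the common final step
  have final : ∀ {Wz Wc s sc t : ℚ}, padicNorm p (Wz - (p : ℚ) ^ 2 * (gHat b p z * s)) ≤ (p : ℚ) ^ (-(3 : ℤ)) →
      padicNorm p (Wc - (p : ℚ) ^ 2 * (gHat b p (conjClass b p z) * sc)) ≤ (p : ℚ) ^ (-(3 : ℤ)) →
      padicNorm p sc ≤ 1 → s - sc = (c : ℚ) * t →
      padicNorm p (Wz + Wc - (p : ℚ) ^ 2 * c * gHat b p z * t) ≤ (p : ℚ) ^ (-(3 : ℤ)) := by
    intro Wz Wc s sc t h1 h2 hsc hst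
    have e : Wz + Wc - (p : ℚ) ^ 2 * c * gHat b p z * t = (Wz - (p : ℚ) ^ 2 * (gHat b p z * s))
        + (Wc - (p : ℚ) ^ 2 * (gHat b p (conjClass b p z) * sc))
        + (p : ℚ) ^ 2 * ((gHat b p (conjClass b p z) + gHat b p z) * sc + gHat b p z * (s - sc - (c : ℚ) * t)) := by ring
    rw [e, hst, sub_self, mul_zero, add_zero]
    refine (padicNorm.nonarchimedean (p := p)).trans (max_le ((padicNorm.nonarchimedean (p := p)).trans (max_le h1 h2)) ?_)
    exact (padicNorm_p_pow_mul_le 2 (padicNorm_mul_le_left hgg hsc)).trans (le_of_eq (by rw [← zpow_add₀ hp0]; norm_num))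
  -- `a·τ = p²ĝ_z (σ(z) − σ(z̄))` is small
  have hat : ∀ {s sc t : ℚ}, padicNorm p s ≤ 1 → padicNorm p sc ≤ 1 → s - sc = (c : ℚ) * t →
      padicNorm p ((p : ℚ) ^ 2 * c * gHat b p z * t) ≤ (p : ℚ) ^ (-(1 : ℤ)) := by
    intro s sc t hs hsc hst
    have e : (p : ℚ) ^ 2 * c * gHat b p z * t = (p : ℚ) ^ 2 * (gHat b p z * ((c : ℚ) * t)) := by ring
    rw [e, ← hst]
    refine (padicNorm_p_pow_mul_le 2 (padicNorm_mul_le_one hg1 ((padicNorm.sub (p := p)).trans (max_le hs hsc)))).trans ?_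
    rw [mul_one]
    exact zpow_le_zpow_right₀ hp1' (by norm_num)
  exact ⟨(p : ℚ) ^ 2 * c * gHat b p z, ⟨hat (hw1 _) (hw1 _) hcW, hat (hv1 _) (hv1 _) hcV⟩,
    final hWz hWc (hw1 _) hcW, final hVz hVc (hv1 _) hcV⟩

end Double

end Summit.KontsevichZagierPeriods.Zeta5Search.SecondOrder

end
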